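import Literature.Topology.FourManifolds.BandSumInTube
import HarnessLib

/-!
# The model of a band sum in tube coordinates: chart, segment data and small knot from a flat arc

Topic `Literature/Topology/FourManifolds`; sequel of `BandSumInTube.lean` in the decomposition
of the Fox–Milnor congruence `Literature.Topology.FourManifolds.Knot.IsConnectedSum.isConcordant`
(remaining named fact `Knot.exists_isConnectedSum_isConcordant_left`,
`BandSumConcordanceCore.lean`). From a knot `Kn` with a flat arc (`Knot.exists_flatArc_param`,
`KnotFlatArc.lean`), an isometric frame `M` turning the arc into the direction `-e₀` and the
height into `e₁`, and three sizes `a` (height of the band), `l` (scale of the small copy) and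
`δ` (collar width), this file builds the numerical model of the band sum in the tube coordinates
`ℝ³ = ℝ_θ × ℝ²_d`: the foliated chart `ChartData` (`BandSumFoliation.lean`), the segment data
`SegData` (`BandSumDetour.lean`), the small knot `KnotPiece` (`BandSumDetourCurve.lean`), the tube
fit `TubeFit` (`BandSumDetourInstance.lean`) and the cleanness hypothesis of `KnotPiece.InTube`
(`BandSumInTube.lean`), together with the facts about the round model sphere
`T (S(0, ρ'))` and ball used by the transport to normal position
(`BandSumNormalTransport.lean`). Everything here is proved and elementary:

* `BandFoliation.ModelData` — the data and its inequalities (all satisfiable by taking `l`,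
  then `δ`, small); `T = affT x₀ p M l` with `x₀ = a e₁`, `k = T ∘ chartCurve Kn`,
  `S = -l σ`, centre `z₀ = T 0` and radius `l ρ'` of the model sphere.
* `ModelData.chart : ChartData` (band `[-lℓ/4, lℓ/4]`, circle = model sphere ∩ `{d₂ = 0}`),
  `ModelData.seg : SegData chart`, `ModelData.piece : KnotPiece chart seg`.
* `ModelData.tubeFit`, `ModelData.lo3/hi3`, `ModelData.clean` — the hypotheses of
  `KnotPiece.InTube` that only concern the model.
* `ModelData.image_T_sphere` (`T (S(0,ρ')) = S(z₀, lρ')`), `B_mem_image_iff` (the chart meets the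
  model sphere exactly in its middle line), `T_mem` (the model ball lies in the core part of the
  region, at positive height), `psi_mem_ball`.
* `BandFoliation.frameOf e s` — the explicit isometry `v ↦ (-⟪v,e⟫, v₂, s (e₀ v₁ - e₁ v₀))`
  (`s = ±1`) with `frameOf_zero/one`, `norm_frameOf`, and `det` of opposite signs for `s = ±1`
  (`toMat_frameOf_neg`).

## References

* R. H. Fox, J. W. Milnor, Osaka J. Math. 3 (1966), §1 (the consumer). [FoxMilnor1966]

## Design notes

No named facts, no `sorry`; `𝔼 n`, `𝕊 n` are local notation as in `Knots.lean`. The coordinate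
form of the norm on `ℝ³` is `BlowDownFlat.norm_sq_eq_three` (`BlowDownFlatModel.lean`, in the
import cone), the coordinate bound is Mathlib's `PiLp.norm_apply_le`, and equality of
`circlePoint`s is read through `exists_eq_add_of_circlePoint_eq`
(`DehnSurgeryTubularNbhdProofs.lean`).
-/

open Set Function Metric
open scoped Topology ContDiff Manifold RealInnerProductSpace

noncomputable section

namespace Literature.Topology.FourManifolds

namespace BandFoliation

open ChartData (e3)
open KnotsInBall Knot.IsConicalConcordance KnotPiece
open BlowDownFlat (norm_sq_eq_three)

/-- Local notation: `𝔼 n` is the model Euclidean space `EuclideanSpace ℝ (Fin n)`. -/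
local notation "𝔼 " n:arg => EuclideanSpace ℝ (Fin n)
/-- Local notation for the unit sphere `𝕊 n ⊆ 𝔼 (n+1)`. -/
local notation "𝕊 " n:arg => Metric.sphere (0 : EuclideanSpace ℝ (Fin (n + 1))) 1

/-! ### Coordinates in `ℝ³` -/

/-- Coordinates of the basis vectors. [folklore] -/
@[simp] theorem e3_apply (i j : Fin 3) : (e3 i : 𝔼 3) j = if j = i then 1 else 0 := by
  simp [ChartData.e3]

/-- The inner product in `ℝ³` in coordinates. [folklore] -/
theorem inner_eq_three (v w : 𝔼 3) : ⟪v, w⟫ = v 0 * w 0 + v 1 * w 1 + v 2 * w 2 := by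
  rw [PiLp.inner_apply, Fin.sum_univ_three]
  simp [mul_comm]

/-- A coordinate is bounded by the norm (Mathlib's `PiLp.norm_apply_le`). [folklore] -/
theorem abs_apply_le_norm (v : 𝔼 3) (i : Fin 3) : |v i| ≤ ‖v‖ := by
  simpa using PiLp.norm_apply_le v i

/-! ### The data of the model -/

/-- **Data of the model band sum in tube coordinates.** A knot `Kn` off the south pole with a
flat arc in the chart `ψ` (`KnotFlatArc.lean`: lowest flat segment `p + s e`, `|s| ≤ ℓ`,
traversed over `[α, β]` as `p + σ θ e`, clean box of height `ν`), a bound `Rb` of `ψ ∘ Kn` and a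
model radius `ρ' ≥ Rb + 1`, a linear isometry `M` with `(M v)₀ = -⟪v, e⟫`, `(M v)₁ = v₂`, and
sizes: the band height `a`, the scale `l` and the collar width `δ`, subject to the smallness
conditions under which the construction works. [folklore] -/
structure ModelData where
  /-- The second summand, off the south pole. -/
  Kn : Knot
  hKn : ∀ y, Kn y ≠ southPole
  /-- The flat point and the direction of the flat segment. -/
  p : 𝔼 3
  e : 𝔼 3
  /-- Half-length of the flat segment and height of the clean box. -/
  ℓ : ℝ
  ν : ℝ
  /-- The parameter window of the flat segment. -/
  α : ℝ
  β : ℝ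
  /-- The traversal of the flat segment. -/
  σ : ℝ → ℝ
  norm_e : ‖e‖ = 1
  e_two : e 2 = 0
  ℓ_pos : 0 < ℓ
  ν_pos : 0 < ν
  lowest : ∀ y, p 2 ≤ psi (Kn y) 2
  box : ∀ y, |⟪psi (Kn y) - p, e⟫| < ℓ → psi (Kn y) 2 < p 2 + ν →
    ∃ s ∈ Icc (-ℓ) ℓ, psi (Kn y) = p + s • e
  α_lt_β : α < β
  β_lt : β < α + 2 * Real.pi
  contDiff_σ : ContDiff ℝ ∞ σ
  deriv_σ_pos : ∀ θ ∈ Icc α β, 0 < deriv σ θ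
  σ_α : σ α = -ℓ
  σ_β : σ β = ℓ
  seg : ∀ θ ∈ Icc α β, psi (Kn (circlePoint θ)) = p + σ θ • e
  /-- A bound of the knot in the chart and the model radius. -/
  Rb : ℝ
  ρ' : ℝ
  norm_le : ∀ y, ‖psi (Kn y)‖ ≤ Rb
  ρ'_ge : Rb + 1 ≤ ρ'
  /-- The frame isometry. -/
  M : 𝔼 3 ≃L[ℝ] 𝔼 3
  M_zero : ∀ v, M v 0 = -⟪v, e⟫
  M_one : ∀ v, M v 1 = v 2
  norm_M : ∀ v, ‖M v‖ = ‖v‖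
  /-- The sizes. -/
  a : ℝ
  l : ℝ
  δ : ℝ
  a_pos : 0 < a
  l_pos : 0 < l
  δ_pos : 0 < δ
  δ_le : δ ≤ 1 / 8
  l_le : 16 * l * ρ' ≤ a
  δ_room : δ * (16 * a * ρ') ≤ l
  δ_up : δ * (16 * ρ' ^ 2) < 1
  δ_clean : δ * (2 * a) ≤ l * ν

namespace ModelData

variable (m : ModelData)

/-! ### Sizes -/

/-- `0 ≤ Rb` (it bounds a norm). [folklore] -/
theorem Rb_nonneg : 0 ≤ m.Rb := le_trans (norm_nonneg _) (m.norm_le (circlePoint 0))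

/-- `1 ≤ ρ'`. [folklore] -/
theorem one_le_ρ' : 1 ≤ m.ρ' := by linarith [m.Rb_nonneg, m.ρ'_ge]

/-- `0 < ρ'`. [folklore] -/
theorem ρ'_pos : 0 < m.ρ' := by linarith [m.one_le_ρ']

/-- `Rb ≤ ρ'`. [folklore] -/
theorem Rb_le : m.Rb ≤ m.ρ' := by linarith [m.ρ'_ge]

/-- `2 l ρ' ≤ a/8`. [folklore] -/
theorem two_l_ρ'_le : 2 * m.l * m.ρ' ≤ m.a / 8 := by linarith [m.l_le]

/-! ### The segment is inside the bound -/

/-- **Points of the flat segment are knot points**, hence bounded by `Rb`. [folklore] -/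
theorem norm_seg_le {s : ℝ} (hs : s ∈ Icc (-m.ℓ) m.ℓ) : ‖m.p + s • m.e‖ ≤ m.Rb := by
  have hivt := intermediate_value_Icc m.α_lt_β.le m.contDiff_σ.continuous.continuousOn
  rw [m.σ_α, m.σ_β] at hivt
  obtain ⟨θ, hθ, hθs⟩ := hivt hs
  rw [← hθs, ← m.seg θ hθ]
  exact m.norm_le _

/-- The flat point is bounded by `Rb`. [folklore] -/
theorem norm_p_le : ‖m.p‖ ≤ m.Rb := by
  have := m.norm_seg_le (s := 0) ⟨by linarith [m.ℓ_pos], m.ℓ_pos.le⟩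
  simpa using this

/-- `|p₂| ≤ ρ'`. [folklore] -/
theorem abs_p_two_le : |m.p 2| ≤ m.ρ' :=
  ((abs_apply_le_norm m.p 2).trans m.norm_p_le).trans m.Rb_le

/-! ### The frame -/

/-- **The frame sends the segment direction to `-e₀`.** [folklore] -/
theorem M_e : m.M m.e = -e3 0 := by
  have h0 : m.M m.e 0 = -1 := by
    rw [m.M_zero, real_inner_self_eq_norm_sq, m.norm_e]; norm_num
  have h1 : m.M m.e 1 = 0 := by rw [m.M_one, m.e_two]
  have hn : ‖m.M m.e‖ ^ 2 = 1 := by rw [m.norm_M, m.norm_e]; norm_num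
  rw [norm_sq_eq_three, h0, h1] at hn
  have h2 : m.M m.e 2 = 0 := by nlinarith
  ext i; fin_cases i <;> simp [h0, h1, h2]

/-- Coordinates of `M v` are bounded by `‖v‖`. [folklore] -/
theorem abs_M_apply_le (v : 𝔼 3) (i : Fin 3) : |m.M v i| ≤ ‖v‖ := by
  rw [← m.norm_M v]; exact abs_apply_le_norm _ i

/-- The frame preserves norms of preimages: `‖M⁻¹ v‖ = ‖v‖`. [folklore] -/
theorem norm_M_symm (v : 𝔼 3) : ‖m.M.symm v‖ = ‖v‖ := by
  conv_rhs => rw [← m.M.apply_symm_apply v]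
  rw [m.norm_M]

/-! ### The affine contraction and the small knot -/

/-- The centre of the small copy on the band line: `x₀ = a e₁`. [folklore] -/
def x₀ : 𝔼 3 := m.a • e3 1

/-- **The affine contraction** `T z = x₀ + l M (z - p)`. [folklore] -/
def T (z : 𝔼 3) : 𝔼 3 := affT m.x₀ m.p m.M m.l z

/-- `T` is `affT x₀ p M l`. [folklore] -/
theorem T_eq : m.T = affT m.x₀ m.p m.M m.l := rfl

/-- Formula for `T`. [folklore] -/
theorem T_apply (z : 𝔼 3) : m.T z = m.x₀ + m.l • m.M (z - m.p) := rfl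

/-- **The centre of the model sphere** `z₀ = T 0 = x₀ - l M p`. [folklore] -/
def z₀ : 𝔼 3 := m.T 0

/-- `T z = z₀ + l M z`. [folklore] -/
theorem T_eq_z₀ (z : 𝔼 3) : m.T z = m.z₀ + m.l • m.M z := by
  simp only [z₀, T_apply, zero_sub, map_neg, map_sub, smul_sub, smul_neg]
  abel

/-- Coordinates of `T z`. [folklore] -/
theorem T_apply_coord (z : 𝔼 3) (i : Fin 3) :
    m.T z i = (if i = 1 then m.a else 0) + m.l * m.M (z - m.p) i := by
  rw [T_apply]
  fin_cases i <;> simp [x₀]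

/-- The `θ`-coordinate of `T z`: `-l ⟪z - p, e⟫`. [folklore] -/
theorem T_apply_zero (z : 𝔼 3) : m.T z 0 = -(m.l * ⟪z - m.p, m.e⟫) := by
  rw [T_apply_coord]; simp only [Fin.zero_eq_one_iff, OfNat.ofNat_ne_one, if_false, zero_add, m.M_zero]; ring

/-- The height of `T z`: `a + l (z₂ - p₂)`. [folklore] -/
theorem T_apply_one (z : 𝔼 3) : m.T z 1 = m.a + m.l * (z 2 - m.p 2) := by
  rw [T_apply_coord]; simp [m.M_one]

/-- `T` is injective. [folklore] -/
theorem injective_T : Injective m.T := injective_affT m.l_pos.ne'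

/-- **The small knot in model coordinates** `k = T ∘ chartCurve Kn`. [folklore] -/
def k (θ : ℝ) : 𝔼 3 := m.T (m.Kn.chartCurve θ)

/-- Formula for `k`. [folklore] -/
theorem k_apply (θ : ℝ) : m.k θ = m.T (psi (m.Kn (circlePoint θ))) := rfl

/-- **The `θ`-coordinate along the flat part**: `S θ = -l σ θ`. [folklore] -/
def S (θ : ℝ) : ℝ := -(m.l * m.σ θ)

/-- **On the window the small knot is the flat line at height `a`.** [folklore] -/
theorem k_flat {θ : ℝ} (hθ : θ ∈ Icc m.α m.β) : m.k θ = m.S θ • e3 0 + m.a • e3 1 := by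
  rw [k_apply, m.seg θ hθ, T_apply, add_sub_cancel_left, map_smul, M_e, S, x₀]
  simp [smul_smul, add_comm]

/-- **The small knot stays at heights `≥ a`.** [folklore] -/
theorem a_le_k_one (θ : ℝ) : m.a ≤ m.k θ 1 := by
  rw [k_apply, T_apply_one]
  have := m.lowest (circlePoint θ)
  nlinarith [m.l_pos]

/-- Distances from the flat point in the chart are at most `2 Rb ≤ 2ρ'`. [folklore] -/
theorem norm_sub_p_le (y : 𝕊 1) : ‖psi (m.Kn y) - m.p‖ ≤ 2 * m.ρ' :=
  calc ‖psi (m.Kn y) - m.p‖ ≤ ‖psi (m.Kn y)‖ + ‖m.p‖ := norm_sub_le _ _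
    _ ≤ m.Rb + m.Rb := add_le_add (m.norm_le y) m.norm_p_le
    _ ≤ 2 * m.ρ' := by linarith [m.Rb_le]

/-- **Coordinates of the small knot**: `|k θ 0| ≤ 2 l ρ'`, `a ≤ k θ 1 ≤ a + 2 l ρ'`,
`|k θ 2| ≤ 2 l ρ'`. [folklore] -/
theorem k_bounds (θ : ℝ) : |m.k θ 0| ≤ 2 * m.l * m.ρ' ∧ m.k θ 1 ≤ m.a + 2 * m.l * m.ρ' ∧
    |m.k θ 2| ≤ 2 * m.l * m.ρ' := by
  have hl := m.l_pos
  have hb := m.norm_sub_p_le (circlePoint θ)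
  have h0 := m.abs_M_apply_le (psi (m.Kn (circlePoint θ)) - m.p) 0
  have h1 := m.abs_M_apply_le (psi (m.Kn (circlePoint θ)) - m.p) 1
  have h2 := m.abs_M_apply_le (psi (m.Kn (circlePoint θ)) - m.p) 2
  refine ⟨?_, ?_, ?_⟩
  · rw [k_apply, T_apply_coord]; simp only [Fin.zero_eq_one_iff, OfNat.ofNat_ne_one, if_false, zero_add]
    rw [abs_mul, abs_of_pos hl]; nlinarith
  · rw [k_apply, T_apply_coord]; simp only [if_true]
    nlinarith [le_abs_self (m.M (psi (m.Kn (circlePoint θ)) - m.p) 1)]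
  · rw [k_apply, T_apply_coord]; simp only [show (2 : Fin 3) ≠ 1 by decide, if_false, zero_add]
    rw [abs_mul, abs_of_pos hl]; nlinarith

/-! ### The band chart -/

/-- The left end of the band: `-lℓ/4`. [folklore] -/
def θlo : ℝ := -(m.l * m.ℓ) / 4

/-- The right end of the band: `lℓ/4`. [folklore] -/
def θhi : ℝ := m.l * m.ℓ / 4

/-- `θ`-coordinate of the centre of the model sphere. [folklore] -/
def mθ : ℝ := m.z₀ 0

/-- Height of the centre of the model sphere. [folklore] -/
def md : ℝ := m.z₀ 1

/-- **Radius of the circle** cut by the plane `d₂ = 0` in the model sphere. [folklore] -/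
def r : ℝ := Real.sqrt ((m.l * m.ρ') ^ 2 - m.z₀ 2 ^ 2)

/-- `0 < l ℓ`. [folklore] -/
theorem lℓ_pos : 0 < m.l * m.ℓ := mul_pos m.l_pos m.ℓ_pos

/-- Coordinates of the centre: `z₀ = (l ⟪p,e⟫, a - l p₂, -l (M p)₂)`. [folklore] -/
theorem z₀_apply : m.z₀ 0 = m.l * ⟪m.p, m.e⟫ ∧ m.z₀ 1 = m.a - m.l * m.p 2 ∧ m.z₀ 2 = -(m.l * m.M m.p 2) := by
  refine ⟨?_, ?_, ?_⟩
  · rw [z₀, T_apply_zero]; simp [inner_neg_left]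
  · rw [z₀, T_apply_one]; simp; ring
  · rw [z₀, T_apply_coord]; simp

/-- `(M p)₂² = ‖p‖² - ⟪p,e⟫² - p₂²`. [folklore] -/
theorem M_p_two_sq : m.M m.p 2 ^ 2 = ‖m.p‖ ^ 2 - ⟪m.p, m.e⟫ ^ 2 - m.p 2 ^ 2 := by
  have h := norm_sq_eq_three (m.M m.p)
  rw [m.norm_M, m.M_zero, m.M_one] at h
  nlinarith

/-- The radicand of `r` is nonnegative, indeed at least `l²`. [folklore] -/
theorem l_sq_le_radicand : m.l ^ 2 ≤ (m.l * m.ρ') ^ 2 - m.z₀ 2 ^ 2 := by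
  obtain ⟨-, -, h2⟩ := m.z₀_apply
  rw [h2, neg_sq, mul_pow, mul_pow, M_p_two_sq]
  have hp := m.norm_p_le
  have hρ := m.ρ'_ge
  have hR := m.Rb_nonneg
  have h1 : ‖m.p‖ ^ 2 ≤ m.Rb ^ 2 := pow_le_pow_left₀ (norm_nonneg _) hp 2
  have h3 : m.l ^ 2 * 1 ≤ m.l ^ 2 * (m.ρ' ^ 2 - ‖m.p‖ ^ 2) :=
    mul_le_mul_of_nonneg_left (by nlinarith) (sq_nonneg _)
  have h4 := mul_nonneg (sq_nonneg m.l) (sq_nonneg ⟪m.p, m.e⟫)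
  have h5 := mul_nonneg (sq_nonneg m.l) (sq_nonneg (m.p 2))
  nlinarith

/-- `r² = (lρ')² - (z₀)₂²`. [folklore] -/
theorem r_sq : m.r ^ 2 = (m.l * m.ρ') ^ 2 - m.z₀ 2 ^ 2 :=
  Real.sq_sqrt (le_trans (sq_nonneg _) m.l_sq_le_radicand)

/-- **The key estimate over the tripled band interval**: for `|θ| ≤ 3lℓ/4`,
`l² (1 + p₂²) ≤ r² - (θ - mθ)²`. [folklore] -/
theorem key_estimate {θ : ℝ} (hθ : |θ| ≤ 3 * (m.l * m.ℓ) / 4) :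
    m.l ^ 2 * (1 + m.p 2 ^ 2) ≤ m.r ^ 2 - (θ - m.mθ) ^ 2 := by
  have hl := m.l_pos
  obtain ⟨h0, -, h2⟩ := m.z₀_apply
  -- the segment point below `θ`
  set s := -θ / m.l with hs
  have hsθ : θ = -(m.l * s) := by rw [hs]; field_simp
  have hsm : s ∈ Icc (-m.ℓ) m.ℓ := by
    rw [abs_le] at hθ
    rw [hs]; constructor
    · rw [le_div_iff₀ hl]; nlinarith
    · rw [div_le_iff₀ hl]; nlinarith
  have hseg := m.norm_seg_le hsm
  have hseg2 : ‖m.p + s • m.e‖ ^ 2 ≤ m.Rb ^ 2 := pow_le_pow_left₀ (norm_nonneg _) hseg 2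
  have hexp : ‖m.p + s • m.e‖ ^ 2 = ‖m.p‖ ^ 2 + 2 * s * ⟪m.p, m.e⟫ + s ^ 2 := by
    rw [norm_add_sq_real, norm_smul, Real.norm_eq_abs, m.norm_e, mul_one, sq_abs, real_inner_smul_right]
    ring
  rw [r_sq, mθ, h0, h2, neg_sq, mul_pow, mul_pow, M_p_two_sq, hsθ]
  have hρ := m.ρ'_ge
  have hR := m.Rb_nonneg
  have hρ1 : m.Rb ^ 2 ≤ (m.ρ' - 1) ^ 2 := pow_le_pow_left₀ hR (by linarith) 2
  have hk : ‖m.p‖ ^ 2 + 2 * s * ⟪m.p, m.e⟫ + s ^ 2 + 1 ≤ m.ρ' ^ 2 := by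
    rw [← hexp]; nlinarith [m.one_le_ρ']
  have hk' := mul_le_mul_of_nonneg_left hk (sq_nonneg m.l)
  nlinarith

/-- Points of the tripled interval satisfy `|θ| ≤ 3lℓ/4`. [folklore] -/
theorem abs_le_of_mem_I2 {θ : ℝ} (hθ : θ ∈ Icc (m.θlo - (m.θhi - m.θlo)) (m.θhi + (m.θhi - m.θlo))) :
    |θ| ≤ 3 * (m.l * m.ℓ) / 4 := by
  rw [θlo, θhi] at hθ; rw [abs_le]; constructor <;> linarith [hθ.1, hθ.2]

/-- **The height of the lower arc of the circle** below `θ`: with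
`W = √(r² - (θ - mθ)²)`, `circLow = md - W`, and `W` satisfies `l|p₂| < W ≤ lρ'`,
`l/(2ρ') ≤ W - l|p₂|`. [folklore] -/
theorem W_facts {θ : ℝ} (hθ : |θ| ≤ 3 * (m.l * m.ℓ) / 4) :
    m.l * |m.p 2| < Real.sqrt (m.r ^ 2 - (θ - m.mθ) ^ 2) ∧
      Real.sqrt (m.r ^ 2 - (θ - m.mθ) ^ 2) ≤ m.l * m.ρ' ∧
      m.l / (2 * m.ρ') ≤ Real.sqrt (m.r ^ 2 - (θ - m.mθ) ^ 2) - m.l * |m.p 2| := by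
  have hl := m.l_pos
  have hρ := m.ρ'_pos
  have hk := m.key_estimate hθ
  set W := Real.sqrt (m.r ^ 2 - (θ - m.mθ) ^ 2) with hW
  have hW0 : 0 ≤ W := Real.sqrt_nonneg _
  have hW2 : W ^ 2 = m.r ^ 2 - (θ - m.mθ) ^ 2 :=
    Real.sq_sqrt (le_trans (by positivity) hk)
  have hp2 := m.abs_p_two_le
  have h1 : m.l * |m.p 2| < W := by
    have : (m.l * |m.p 2|) ^ 2 < W ^ 2 := by rw [hW2, mul_pow, sq_abs]; nlinarith [mul_pos hl hl]
    exact lt_of_pow_lt_pow_left₀ 2 hW0 this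
  have h2 : W ≤ m.l * m.ρ' := by
    have hr : m.r ^ 2 ≤ (m.l * m.ρ') ^ 2 := by rw [r_sq]; nlinarith [sq_nonneg (m.z₀ 2)]
    have : W ^ 2 ≤ (m.l * m.ρ') ^ 2 := by rw [hW2]; nlinarith [sq_nonneg (θ - m.mθ)]
    exact le_of_pow_le_pow_left₀ (by norm_num) (by positivity) this
  refine ⟨h1, h2, ?_⟩
  -- `(W - l|p₂|)(W + l|p₂|) = W² - l²p₂² ≥ l²` and `W + l|p₂| ≤ 2lρ'`
  have hprod : m.l ^ 2 ≤ (W - m.l * |m.p 2|) * (W + m.l * |m.p 2|) := by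
    have : (W - m.l * |m.p 2|) * (W + m.l * |m.p 2|) = W ^ 2 - m.l ^ 2 * |m.p 2| ^ 2 := by ring
    rw [this, hW2, sq_abs]; linarith
  have hsum : W + m.l * |m.p 2| ≤ 2 * m.l * m.ρ' := by nlinarith
  rw [div_le_iff₀ (by positivity)]
  have hd : 0 ≤ W - m.l * |m.p 2| := by linarith
  nlinarith [mul_le_mul_of_nonneg_left hsum hd]

/-- **The foliated band chart of the model.** Band `[-lℓ/4, lℓ/4]`, circle cut by the plane
`d₂ = 0` in the model sphere `S(z₀, lρ')`, collar width `δ`. [folklore] -/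
def chart : ChartData where
  a := m.a
  mθ := m.mθ
  md := m.md
  r := m.r
  θlo := m.θlo
  θhi := m.θhi
  δ := m.δ
  a_pos := m.a_pos
  δ_pos := m.δ_pos
  δ_le := m.δ_le
  θlo_lt := by rw [θlo, θhi]; linarith [m.lℓ_pos]
  sq_lt θ hθ := by
    have := m.key_estimate (m.abs_le_of_mem_I2 hθ)
    nlinarith [mul_pos m.l_pos m.l_pos, sq_nonneg (m.p 2)]
  low_gt θ hθ := by
    obtain ⟨-, h2, -⟩ := m.W_facts (m.abs_le_of_mem_I2 hθ)
    obtain ⟨-, h1, -⟩ := m.z₀_apply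
    rw [circLow, md, h1]
    have := m.two_l_ρ'_le; have := m.a_pos
    have hp' : m.l * m.p 2 ≤ m.l * m.ρ' :=
      mul_le_mul_of_nonneg_left ((le_abs_self _).trans m.abs_p_two_le) m.l_pos.le
    linarith
  low_lt θ hθ := by
    obtain ⟨h0, -, -⟩ := m.W_facts (m.abs_le_of_mem_I2 hθ)
    obtain ⟨-, h1, -⟩ := m.z₀_apply
    rw [circLow, md, h1]
    have hp : -(m.l * m.p 2) ≤ m.l * |m.p 2| := by
      rw [← mul_neg]; exact mul_le_mul_of_nonneg_left (neg_le_abs _) m.l_pos.le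
    linarith
  room θ hθ := by
    obtain ⟨h0, -, h3⟩ := m.W_facts (m.abs_le_of_mem_I2 hθ)
    obtain ⟨-, h1, -⟩ := m.z₀_apply
    rw [circLow, md, h1]
    have hρ := m.ρ'_pos; have ha := m.a_pos; have hl := m.l_pos
    have hroom : 8 * m.δ * m.a ≤ m.l / (2 * m.ρ') := by
      rw [le_div_iff₀ (by positivity)]; nlinarith [m.δ_room]
    have hp : -(m.l * m.p 2) ≤ m.l * |m.p 2| := by
      rw [← mul_neg]; exact mul_le_mul_of_nonneg_left (neg_le_abs _) m.l_pos.le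
    linarith
  up θ hθ := by
    obtain ⟨h0, h2, h3⟩ := m.W_facts (m.abs_le_of_mem_I2 hθ)
    obtain ⟨-, h1, -⟩ := m.z₀_apply
    rw [circLow, md, h1]
    have hρ := m.ρ'_pos; have ha := m.a_pos; have hl := m.l_pos; have hδ := m.δ_pos
    set W := Real.sqrt (m.r ^ 2 - (θ - m.mθ) ^ 2) with hW
    have hp : -(m.l * m.p 2) ≤ m.l * |m.p 2| := by
      rw [← mul_neg]; exact mul_le_mul_of_nonneg_left (neg_le_abs _) m.l_pos.le
    have hp' : m.l * m.p 2 ≤ m.l * |m.p 2| := mul_le_mul_of_nonneg_left (le_abs_self _) m.l_pos.le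
    -- `4δ (l p₂ + W) ≤ 8 δ l ρ' < l/(2ρ') ≤ W - l p₂`
    have hup : 8 * m.δ * m.l * m.ρ' < m.l / (2 * m.ρ') := by
      rw [lt_div_iff₀ (by positivity)]; nlinarith [m.δ_up]
    nlinarith

/-- The chart's data, recalled. [folklore] -/
@[simp] theorem chart_a : m.chart.a = m.a := rfl
/-- The chart's data, recalled. [folklore] -/
@[simp] theorem chart_δ : m.chart.δ = m.δ := rfl
/-- The chart's data, recalled. [folklore] -/
@[simp] theorem chart_θlo : m.chart.θlo = m.θlo := rfl
/-- The chart's data, recalled. [folklore] -/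
@[simp] theorem chart_θhi : m.chart.θhi = m.θhi := rfl
/-- The chart's data, recalled. [folklore] -/
@[simp] theorem chart_mθ : m.chart.mθ = m.mθ := rfl
/-- The chart's data, recalled. [folklore] -/
@[simp] theorem chart_md : m.chart.md = m.md := rfl
/-- The chart's data, recalled. [folklore] -/
@[simp] theorem chart_r : m.chart.r = m.r := rfl
/-- The width of the band is `lℓ/2`. [folklore] -/
theorem chart_wid : m.chart.wid = m.l * m.ℓ / 2 := by
  rw [ChartData.wid, chart_θlo, chart_θhi, θlo, θhi]; ring

/-! ### The segment data -/

/-- **The segment data of the model**: `S = -lσ` over `[α, β]`, junction width `c₁ = lℓ/16`.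
[folklore] -/
def seg' : SegData m.chart where
  S := m.S
  α := m.α
  β := m.β
  c₁ := m.l * m.ℓ / 16
  contDiff_S := (contDiff_const.mul m.contDiff_σ).neg
  α_lt_β := m.α_lt_β
  β_lt := m.β_lt
  deriv_S_neg θ hθ := by
    have hd : HasDerivAt m.S (-(m.l * deriv m.σ θ)) θ :=
      (((m.contDiff_σ.differentiable (by simp)) θ).hasDerivAt.const_mul m.l).neg
    rw [hd.deriv, neg_lt_zero]
    exact mul_pos m.l_pos (m.deriv_σ_pos θ hθ)
  S_β_lt := by
    rw [chart_wid, chart_θlo, θlo, S, m.σ_β]; linarith [m.lℓ_pos]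
  lt_S_α := by
    rw [chart_wid, chart_θhi, θhi, S, m.σ_α]; linarith [m.lℓ_pos]
  c₁_pos := by linarith [m.lℓ_pos]
  c₁_le := by
    rw [chart_wid, chart_δ]
    have hδ := m.δ_le; have hδ' := m.δ_pos; have h := m.lℓ_pos
    rw [div_div, le_div_iff₀ (by positivity)]
    nlinarith
  c₁_lt := by rw [chart_wid]; linarith [m.lℓ_pos]

/-- The segment data's `S`, recalled. [folklore] -/
@[simp] theorem seg'_S : m.seg'.S = m.S := rfl
/-- The segment data's window, recalled. [folklore] -/
@[simp] theorem seg'_α : m.seg'.α = m.α := rfl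
/-- The segment data's window, recalled. [folklore] -/
@[simp] theorem seg'_β : m.seg'.β = m.β := rfl

/-! ### The small knot piece -/

/-- `circlePoint s = circlePoint t` forces `t = s + m 2π` (`exists_eq_add_of_circlePoint_eq`).
[folklore] -/
theorem exists_of_circlePoint_eq {s t : ℝ} (h : circlePoint s = circlePoint t) :
    ∃ m : ℤ, t = s + m * (2 * Real.pi) := by
  obtain ⟨k, hk⟩ := exists_eq_add_of_circlePoint_eq h
  exact ⟨-k, by push_cast; linarith⟩

/-- **The small knot piece of the model.** [folklore] -/
def piece : KnotPiece m.chart m.seg' where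
  k := m.k
  contDiff_k := (contDiff_affT _ _ _ _).comp (Knot.contDiff_chartCurve m.hKn)
  periodic_k θ := by
    show m.T (m.Kn.chartCurve (θ + 2 * Real.pi)) = m.T (m.Kn.chartCurve θ)
    rw [m.Kn.periodic_chartCurve]
  deriv_k_ne_zero θ := by
    have hd : HasDerivAt m.k ((m.l • (m.M : 𝔼 3 →L[ℝ] 𝔼 3)) (deriv m.Kn.chartCurve θ)) θ := by
      have h1 := ((Knot.contDiff_chartCurve m.hKn).differentiable (by simp) θ).hasDerivAt
      exact (hasFDerivAt_affT m.x₀ m.p m.M m.l _).comp_hasDerivAt θ h1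
    rw [hd.deriv]
    intro h0
    have h0' : m.l • m.M (deriv m.Kn.chartCurve θ) = 0 := h0
    rw [smul_eq_zero] at h0'
    rcases h0' with h | h
    · exact m.l_pos.ne' h
    · exact Knot.deriv_chartCurve_ne_zero m.hKn θ (m.M.injective (by rw [h, map_zero]))
  k_inj s t hst := by
    have h1 : m.Kn.chartCurve s = m.Kn.chartCurve t := m.injective_T hst
    exact exists_of_circlePoint_eq ((Knot.chartCurve_eq_iff m.hKn).1 h1)
  flat θ hθ := m.k_flat hθ
  above θ := m.a_le_k_one θ

/-- The small knot piece's curve, recalled. [folklore] -/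
@[simp] theorem piece_k : m.piece.k = m.k := rfl

/-! ### The tube fit and the cleanness -/

/-- **The model fits in the tube** of half-width `η` and radius `ε` as soon as `η ≤ 1`,
`lℓ ≤ η/8`, `8lρ' ≤ η` and `2a < ε`. [folklore] -/
theorem tubeFit {η ε : ℝ} (hη : η ≤ 1) (hℓη : m.l * m.ℓ ≤ η / 8) (hρη : 8 * m.l * m.ρ' ≤ η)
    (haε : 2 * m.a < ε) : m.piece.TubeFit η ε where
  η_le := hη
  lo := by rw [chart_θlo, θlo]; linarith [m.lℓ_pos]
  hi := by rw [chart_θhi, θhi]; linarith [m.lℓ_pos]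
  kθ θ := by
    obtain ⟨h0, -, -⟩ := m.k_bounds θ
    rw [abs_le] at h0
    rw [piece_k]; exact ⟨by linarith [h0.1], by linarith [h0.2]⟩
  kd θ := by
    obtain ⟨-, h1, h2⟩ := m.k_bounds θ
    have ha := m.a_le_k_one θ
    have := m.two_l_ρ'_le; have := m.a_pos
    rw [abs_le] at h2
    rw [piece_k, mem_ball_zero_iff, Prod.norm_mk, Real.norm_eq_abs, Real.norm_eq_abs, max_lt_iff, abs_lt, abs_lt]
    exact ⟨⟨by linarith, by linarith⟩, ⟨by linarith, by linarith⟩⟩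
  two_a_lt := haε

/-- The tripled band interval lies in the arc `[-η/8, η/8]` when `lℓ ≤ η/8`. [folklore] -/
theorem lo3 {η : ℝ} (hℓη : m.l * m.ℓ ≤ η / 8) : -(η / 8) ≤ m.chart.θlo - m.chart.wid := by
  rw [chart_wid, chart_θlo, θlo]; linarith [m.lℓ_pos]

/-- The tripled band interval lies in the arc `[-η/8, η/8]` when `lℓ ≤ η/8`. [folklore] -/
theorem hi3 {η : ℝ} (hℓη : m.l * m.ℓ ≤ η / 8) : m.chart.θhi + m.chart.wid ≤ η / 8 := by
  rw [chart_wid, chart_θhi, θhi]; linarith [m.lℓ_pos]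

/-- **The small knot is clean near the band**: a point of `k` over the tripled interval at height
below `a + 2aδ` is a point of the flat part (the clean box of the flat arc, read through `T`).
[folklore] -/
theorem clean (θ : ℝ) (h0 : m.piece.k θ 0 ∈ Ioo (m.chart.θlo - m.chart.wid) (m.chart.θhi + m.chart.wid))
    (h1 : m.piece.k θ 1 < m.chart.a + 2 * m.chart.a * m.chart.δ) :
    ∃ θ' ∈ Icc m.seg'.α m.seg'.β, ∃ n : ℤ, θ = θ' + n * (2 * Real.pi) := by
  have hl := m.l_pos
  rw [chart_wid, chart_θlo, chart_θhi, θlo, θhi, piece_k, k_apply, T_apply_zero] at h0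
  rw [chart_a, chart_δ, piece_k, k_apply, T_apply_one] at h1
  set z := psi (m.Kn (circlePoint θ)) with hz
  -- the box conditions
  have hb1 : |⟪z - m.p, m.e⟫| < m.ℓ := by
    rw [abs_lt]; constructor <;> nlinarith [h0.1, h0.2]
  have hb2 : z 2 < m.p 2 + m.ν := by
    have hc := m.δ_clean
    nlinarith
  obtain ⟨s, hs, hzs⟩ := m.box (circlePoint θ) hb1 hb2
  -- `s = σ θ'`
  have hivt := intermediate_value_Icc m.α_lt_β.le m.contDiff_σ.continuous.continuousOn
  rw [m.σ_α, m.σ_β] at hivt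
  obtain ⟨θ', hθ', hθ's⟩ := hivt hs
  refine ⟨θ', hθ', ?_⟩
  have heq : m.Kn.chartCurve θ' = m.Kn.chartCurve θ := by
    rw [Knot.chartCurve_apply, Knot.chartCurve_apply, m.seg θ' hθ', hθ's, ← hzs]
  exact exists_of_circlePoint_eq ((Knot.chartCurve_eq_iff m.hKn).1 heq)

/-! ### The model sphere and ball -/

/-- **The image of the sphere `S(0, ρ')` under `T` is the round sphere `S(z₀, lρ')`.** [folklore] -/
theorem image_T_sphere : m.T '' sphere (0 : 𝔼 3) m.ρ' = sphere m.z₀ (m.l * m.ρ') := by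
  have hl := m.l_pos
  ext y
  constructor
  · rintro ⟨z, hz, rfl⟩
    rw [mem_sphere_iff_norm, T_eq_z₀, add_sub_cancel_left, norm_smul, Real.norm_of_nonneg hl.le, m.norm_M,
      mem_sphere_zero_iff_norm.1 hz]
  · intro hy
    refine ⟨m.M.symm (m.l⁻¹ • (y - m.z₀)), ?_, ?_⟩
    · rw [mem_sphere_zero_iff_norm, norm_M_symm, norm_smul, Real.norm_of_nonneg (inv_nonneg.2 hl.le),
        mem_sphere_iff_norm.1 hy]
      field_simp
    · rw [T_eq_z₀, m.M.apply_symm_apply, smul_smul, mul_inv_cancel₀ hl.ne', one_smul, add_sub_cancel]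

/-- A point of the plane `d₂ = 0` lies on the model sphere iff it lies on the circle of the chart.
[folklore] -/
theorem mem_sphere_iff_circle {y : 𝔼 3} (hy : y 2 = 0) :
    y ∈ sphere m.z₀ (m.l * m.ρ') ↔ (y 0 - m.mθ) ^ 2 + (y 1 - m.md) ^ 2 = m.r ^ 2 := by
  have hl := m.l_pos; have hρ := m.ρ'_pos
  rw [mem_sphere_iff_norm, ← sq_eq_sq₀ (norm_nonneg _) (by positivity), norm_sq_eq_three, r_sq, mθ, md]
  simp only [PiLp.sub_apply, hy, zero_sub, neg_sq]
  constructor <;> intro h <;> linarith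

/-- **The chart meets the model sphere exactly in its middle line**: for `x` in the open square,
`B x ∈ T (S(0, ρ'))` iff `x 0 = 1/2`. [folklore] -/
theorem B_mem_image_iff {x : EuclideanSpace ℝ (Fin 2)} (hx : x ∈ squareNhd m.δ) :
    m.chart.B x ∈ m.T '' sphere (0 : 𝔼 3) m.ρ' ↔ x 0 = 2⁻¹ := by
  rw [image_T_sphere, m.mem_sphere_iff_circle (ChartData.B_apply_two _ _),
    show (2⁻¹ : ℝ) = 1 / 2 by norm_num]
  exact m.chart.mem_circle_iff ⟨(hx 0).1.le, (hx 0).2.le⟩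

/-- **The model ball lies in the core part of the region, at positive height**: for
`‖z‖ ≤ ρ'`, `|T z 0| ≤ 2lρ'`, `0 < a - 2lρ' ≤ T z 1 ≤ a + 2lρ'`, `|T z 2| ≤ 2lρ'`. [folklore] -/
theorem T_bounds {z : 𝔼 3} (hz : z ∈ closedBall (0 : 𝔼 3) m.ρ') :
    |m.T z 0| ≤ 2 * m.l * m.ρ' ∧ m.a - 2 * m.l * m.ρ' ≤ m.T z 1 ∧ m.T z 1 ≤ m.a + 2 * m.l * m.ρ' ∧
      |m.T z 2| ≤ 2 * m.l * m.ρ' := by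
  have hl := m.l_pos
  have hzp : ‖z - m.p‖ ≤ 2 * m.ρ' :=
    calc ‖z - m.p‖ ≤ ‖z‖ + ‖m.p‖ := norm_sub_le _ _
      _ ≤ m.ρ' + m.Rb := add_le_add (mem_closedBall_zero_iff.1 hz) m.norm_p_le
      _ ≤ 2 * m.ρ' := by linarith [m.Rb_le]
  have h0 := m.abs_M_apply_le (z - m.p) 0
  have h1 := m.abs_M_apply_le (z - m.p) 1
  have h2 := m.abs_M_apply_le (z - m.p) 2
  rw [abs_le] at h1
  refine ⟨?_, ?_, ?_, ?_⟩
  · rw [T_apply_coord]; simp only [Fin.zero_eq_one_iff, OfNat.ofNat_ne_one, if_false, zero_add]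
    rw [abs_mul, abs_of_pos hl]; nlinarith
  · rw [T_apply_coord]; simp only [if_true]; nlinarith
  · rw [T_apply_coord]; simp only [if_true]; nlinarith
  · rw [T_apply_coord]; simp only [show (2 : Fin 3) ≠ 1 by decide, if_false, zero_add]
    rw [abs_mul, abs_of_pos hl]; nlinarith

/-- **The model ball lies over the core strip, inside the radius and off the core line**, when
`8lρ' ≤ η` and `2a < ε`. [folklore] -/
theorem T_mem {η ε : ℝ} (hρη : 8 * m.l * m.ρ' ≤ η) (haε : 2 * m.a < ε) {z : 𝔼 3}
    (hz : z ∈ closedBall (0 : 𝔼 3) m.ρ') :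
    m.T z 0 ∈ Icc (-(η / 4)) (η / 4) ∧ ((m.T z 1, m.T z 2) : ℝ × ℝ) ∈ ball (0 : ℝ × ℝ) ε ∧
      0 < m.T z 1 ∧ m.T z ∈ region 0 η ε := by
  obtain ⟨h0, h1, h1', h2⟩ := m.T_bounds hz
  have := m.two_l_ρ'_le; have ha := m.a_pos; have hl := m.l_pos; have hρ := m.ρ'_pos
  rw [abs_le] at h0 h2
  have hη : 0 < η := by nlinarith
  have hball : ((m.T z 1, m.T z 2) : ℝ × ℝ) ∈ ball (0 : ℝ × ℝ) ε := by
    rw [mem_ball_zero_iff, Prod.norm_mk, Real.norm_eq_abs, Real.norm_eq_abs, max_lt_iff, abs_lt, abs_lt]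
    exact ⟨⟨by linarith, by linarith⟩, ⟨by linarith, by linarith⟩⟩
  exact ⟨⟨by linarith, by linarith⟩, hball, by linarith, ⟨by linarith, by linarith⟩, hball⟩

/-- The knot in the chart lies in the open model ball. [folklore] -/
theorem psi_mem_ball (y : 𝕊 1) : psi (m.Kn y) ∈ ball (0 : 𝔼 3) m.ρ' :=
  mem_ball_zero_iff.2 (lt_of_le_of_lt (m.norm_le y) (by linarith [m.ρ'_ge]))

end ModelData

/-! ### The explicit frame isometry -/

section Frame

variable (e : 𝔼 3) (s : ℝ)

/-- **The frame** `v ↦ (-⟪v, e⟫, v₂, s (e₀ v₁ - e₁ v₀))` as a linear map. [folklore] -/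
def frameLin : 𝔼 3 →ₗ[ℝ] 𝔼 3 where
  toFun v := WithLp.toLp 2 ![-⟪v, e⟫, v 2, s * (e 0 * v 1 - e 1 * v 0)]
  map_add' v w := by
    ext i; fin_cases i <;> (simp [inner_add_left]; try ring)
  map_smul' c v := by
    ext i; fin_cases i <;> (simp [real_inner_smul_left]; try ring)

/-- Coordinates of the frame. [folklore] -/
theorem frameLin_apply (v : 𝔼 3) : frameLin e s v 0 = -⟪v, e⟫ ∧ frameLin e s v 1 = v 2 ∧
    frameLin e s v 2 = s * (e 0 * v 1 - e 1 * v 0) := by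
  refine ⟨?_, ?_, ?_⟩ <;> simp [frameLin]

variable {e s}

/-- **The frame is an isometry** when `‖e‖ = 1`, `e₂ = 0` and `s = ±1`. [folklore] -/
theorem norm_frameLin (he : ‖e‖ = 1) (he2 : e 2 = 0) (hs : s ^ 2 = 1) (v : 𝔼 3) :
    ‖frameLin e s v‖ = ‖v‖ := by
  have h1 : ‖frameLin e s v‖ ^ 2 = ‖v‖ ^ 2 := by
    obtain ⟨h0, h1, h2⟩ := frameLin_apply e s v
    rw [norm_sq_eq_three, norm_sq_eq_three v, h0, h1, h2, inner_eq_three, he2]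
    have hee : e 0 ^ 2 + e 1 ^ 2 = 1 := by
      have := norm_sq_eq_three e; rw [he, he2] at this; nlinarith
    linear_combination (v 0 ^ 2 + v 1 ^ 2) * hee + (e 0 * v 1 - e 1 * v 0) ^ 2 * hs
  exact (sq_eq_sq₀ (norm_nonneg _) (norm_nonneg _)).1 h1

/-- The frame as a linear isometry. [folklore] -/
def frameIso (he : ‖e‖ = 1) (he2 : e 2 = 0) (hs : s ^ 2 = 1) : 𝔼 3 →ₗᵢ[ℝ] 𝔼 3 :=
  ⟨frameLin e s, norm_frameLin he he2 hs⟩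

/-- **The frame as a continuous linear automorphism of `ℝ³`** (a linear isometry of a
finite-dimensional space onto itself). [folklore] -/
def frameOf (he : ‖e‖ = 1) (he2 : e 2 = 0) (hs : s ^ 2 = 1) : 𝔼 3 ≃L[ℝ] 𝔼 3 :=
  ((frameIso he he2 hs).toLinearIsometryEquiv rfl).toContinuousLinearEquiv

/-- The frame automorphism acts as the frame. [folklore] -/
theorem frameOf_apply (he : ‖e‖ = 1) (he2 : e 2 = 0) (hs : s ^ 2 = 1) (v : 𝔼 3) :
    frameOf he he2 hs v = frameLin e s v := rfl

/-- First coordinate of the frame automorphism. [folklore] -/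
theorem frameOf_zero (he : ‖e‖ = 1) (he2 : e 2 = 0) (hs : s ^ 2 = 1) (v : 𝔼 3) :
    frameOf he he2 hs v 0 = -⟪v, e⟫ := (frameLin_apply e s v).1

/-- Second coordinate of the frame automorphism. [folklore] -/
theorem frameOf_one (he : ‖e‖ = 1) (he2 : e 2 = 0) (hs : s ^ 2 = 1) (v : 𝔼 3) :
    frameOf he he2 hs v 1 = v 2 := (frameLin_apply e s v).2.1

/-- The frame automorphism is an isometry. [folklore] -/
theorem norm_frameOf (he : ‖e‖ = 1) (he2 : e 2 = 0) (hs : s ^ 2 = 1) (v : 𝔼 3) :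
    ‖frameOf he he2 hs v‖ = ‖v‖ := norm_frameLin he he2 hs v

/-- The reflection in the plane `d₂ = 0`: `(v₀, v₁, v₂) ↦ (v₀, v₁, -v₂)`. [folklore] -/
def reflTwo : 𝔼 3 →L[ℝ] 𝔼 3 :=
  LinearMap.toContinuousLinearMap
    { toFun := fun v ↦ WithLp.toLp 2 ![v 0, v 1, -v 2]
      map_add' := fun v w ↦ by ext i; fin_cases i <;> (simp; try ring)
      map_smul' := fun c v ↦ by ext i; fin_cases i <;> simp }

/-- The frames of opposite signs differ by the reflection. [folklore] -/
theorem frameOf_neg_eq (he : ‖e‖ = 1) (he2 : e 2 = 0) (hs : s ^ 2 = 1) (hs' : (-s) ^ 2 = 1) :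
    (frameOf he he2 hs' : 𝔼 3 →L[ℝ] 𝔼 3) = reflTwo.comp (frameOf he he2 hs : 𝔼 3 →L[ℝ] 𝔼 3) := by
  ext v i
  rw [ContinuousLinearMap.comp_apply]
  simp only [ContinuousLinearEquiv.coe_coe, frameOf_apply]
  fin_cases i <;> simp [frameLin, reflTwo]

/-- The matrix of the reflection has determinant `-1`. [folklore] -/
theorem det_toMat_reflTwo : (AffineIsotopy.toMat reflTwo).det = -1 := by
  have h : AffineIsotopy.toMat reflTwo = Matrix.diagonal ![1, 1, -1] := by
    rw [← AffineIsotopy.toMat_toCLM (Matrix.diagonal ![1, 1, -1])]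
    congr 1
    ext v i
    rw [AffineIsotopy.toCLM_apply]
    fin_cases i <;> simp [reflTwo, Matrix.diagonal]
  rw [h, Matrix.det_diagonal]
  simp [Fin.prod_univ_three]

/-- **The frames of opposite signs have determinants of opposite signs** (after composition with
any operator `A`). [folklore] -/
theorem det_toMat_comp_frameOf_neg (A : 𝔼 3 →L[ℝ] 𝔼 3) (he : ‖e‖ = 1) (he2 : e 2 = 0)
    (hs : s ^ 2 = 1) (hs' : (-s) ^ 2 = 1) :
    (AffineIsotopy.toMat (A.comp (frameOf he he2 hs' : 𝔼 3 →L[ℝ] 𝔼 3))).det =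
      -(AffineIsotopy.toMat (A.comp (frameOf he he2 hs : 𝔼 3 →L[ℝ] 𝔼 3))).det := by
  rw [frameOf_neg_eq he he2 hs hs', ← ContinuousLinearMap.comp_assoc, AffineIsotopy.toMat_comp,
    AffineIsotopy.toMat_comp, AffineIsotopy.toMat_comp, Matrix.det_mul, Matrix.det_mul, Matrix.det_mul,
    det_toMat_reflTwo]
  ring

/-- The frame composed with an invertible operator has nonzero determinant. [folklore] -/
theorem det_toMat_comp_frameOf_ne_zero (A : 𝔼 3 ≃L[ℝ] 𝔼 3) (he : ‖e‖ = 1) (he2 : e 2 = 0)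
    (hs : s ^ 2 = 1) :
    (AffineIsotopy.toMat ((A : 𝔼 3 →L[ℝ] 𝔼 3).comp (frameOf he he2 hs : 𝔼 3 →L[ℝ] 𝔼 3))).det ≠ 0 := by
  have : (A : 𝔼 3 →L[ℝ] 𝔼 3).comp (frameOf he he2 hs : 𝔼 3 →L[ℝ] 𝔼 3) =
      ((frameOf he he2 hs).trans A : 𝔼 3 ≃L[ℝ] 𝔼 3) := rfl
  rw [this]
  intro h0
  -- the product with the matrix of the inverse is `1`
  have hprod : AffineIsotopy.toMat (((frameOf he he2 hs).trans A : 𝔼 3 ≃L[ℝ] 𝔼 3) : 𝔼 3 →L[ℝ] 𝔼 3) *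
      AffineIsotopy.toMat ((((frameOf he he2 hs).trans A).symm : 𝔼 3 ≃L[ℝ] 𝔼 3) : 𝔼 3 →L[ℝ] 𝔼 3) = 1 := by
    rw [← AffineIsotopy.toMat_comp, ContinuousLinearEquiv.coe_comp_coe_symm, AffineIsotopy.toMat_id]
  have := congrArg Matrix.det hprod
  rw [Matrix.det_mul, Matrix.det_one, h0, zero_mul] at this
  exact zero_ne_one this

/-- **One of the two frames is orientation-compatible** with a given invertible operator.
[folklore] -/
theorem exists_frameOf_det_pos (A : 𝔼 3 ≃L[ℝ] 𝔼 3) (he : ‖e‖ = 1) (he2 : e 2 = 0) :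
    ∃ (s : ℝ) (hs : s ^ 2 = 1),
      0 < (AffineIsotopy.toMat ((A : 𝔼 3 →L[ℝ] 𝔼 3).comp (frameOf he he2 hs : 𝔼 3 →L[ℝ] 𝔼 3))).det := by
  have h1 : (1 : ℝ) ^ 2 = 1 := by norm_num
  have h1' : (-(1 : ℝ)) ^ 2 = 1 := by norm_num
  rcases lt_or_gt_of_ne (det_toMat_comp_frameOf_ne_zero A he he2 h1) with h | h
  · refine ⟨-1, h1', ?_⟩
    rw [det_toMat_comp_frameOf_neg (A : 𝔼 3 →L[ℝ] 𝔼 3) he he2 h1 h1']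
    linarith
  · exact ⟨1, h1, h⟩

end Frame

end BandFoliation

end Literature.Topology.FourManifolds
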